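import Summits.CriticalPhenomena.PercolationContinuityZ3.Theorems.PercNonProliferationSubpolynomialBlockingSubsurface
import HarnessLib

/-!
# `SubpolynomialBlocking`, line `SketchIdeator5` (two-sided charging floor) — stub `stub_inArm_le_halfSpaceReach`

Support file for crux item stmt-CriticalPhenomena-4446. For a site `v` of the mid-sphere `∂ⁱⁿΛ_m`,
`m = n + ⌊n/2⌋`, the inward arm `inArm v n = {∃ x ∈ Λ_n, v ↔ x by an open path inside Λ_m}` has
probability at most that of the half-space reach event of depth `⌊n/2⌋`
(`CerfDembinVanishing.halfSpaceReach 3 ⌊n/2⌋ = {0 ↔ height ≥ ⌊n/2⌋ inside ℍ}`): on lattice configurations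
`inArm v n ⊆ {∃ x ∈ Λ_{m - ⌊n/2⌋}, v ↔ x via withinGraph (zdGraph 3) Λ_m}` (the tree's "active site" event),
whose probability `Subsurface.real_active_le_halfSpaceReach` (Cerf–Dembin 2020 §2 symmetry, tree) bounds by
`μ(halfSpaceReach 3 ⌊n/2⌋)`.
-/

noncomputable section

namespace Summit.CriticalPhenomena.PercolationContinuityZ3.Theorems.SubpolynomialBlocking

open MeasureTheory Filter Topology
open Literature.Probability.Percolation Literature.Probability.LatticeModels
open Literature.Probability.Percolation.DCT16
open Literature.Probability.Percolation.CerfDembinVanishing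

/-- On a lattice configuration `ω ⊆ E(ℤ^d)`, an open path inside `Λ_m` from `v ∈ Λ_m` to `x`
(`openConnIn`) makes `x` a member of the `withinGraph (zdGraph d) Λ_m`-constrained cluster of `v`
(`openConnVia`). -/
theorem mem_openConnVia_withinGraph_of_mem_openConnIn {d : ℕ} {m : ℕ} {v x : Site d}
    {ω : BondConfig (Site d)} (hω : ω ⊆ (zdGraph d).edgeSet)
    (hvm : v ∈ (↑(box d m) : Set (Site d)))
    (h : ω ∈ openConnIn (↑(box d m) : Set (Site d)) v x) :
    ω ∈ openConnVia (withinGraph (zdGraph d) ↑(box d m)) v x := by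
  rw [openConnIn_eq_openConnVia hvm] at h
  change x ∈ openClusterIn (withinGraph (zdGraph d) ↑(box d m)) ω v
  rw [openClusterIn_withinGraph_eq_top (zdGraph d) (↑(box d m) : Set (Site d)) hω]
  exact h

/-- **Stub `stub_inArm_le_halfSpaceReach`** (line `SketchIdeator5`): for `v ∈ ∂ⁱⁿΛ_m`, `m = n + ⌊n/2⌋`,
`μ(inArm v n) ≤ μ(halfSpaceReach 3 ⌊n/2⌋)` — the inclusion of `inArm v n` in the active-site event of depth
`⌊n/2⌋` (up to the null set of non-lattice configurations, `real_mono_of_forall_subset_edgeSet`) followed by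
the Cerf–Dembin symmetry bound `Subsurface.real_active_le_halfSpaceReach` with `t = ⌊n/2⌋ ≤ m`. -/
theorem stub_inArm_le_halfSpaceReach :
    ∀ (p : unitInterval) (n : ℕ) (v : Site 3), v ∈ innerBoundary (zdGraph 3) (box 3 (n + n / 2)) →
      (bondPercolation (zdGraph 3) p).real
          {ω | ∃ x ∈ box 3 n, ω ∈ openConnIn (↑(box 3 (n + n / 2)) : Set (Site 3)) v x} ≤
        (bondPercolation (zdGraph 3) p).real (halfSpaceReach 3 (n / 2)) := by
  intro p n v hv
  have hvm : v ∈ (↑(box 3 (n + n / 2)) : Set (Site 3)) :=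
    Finset.mem_coe.2 (mem_innerBoundary_iff.1 hv).1
  have htm : n / 2 ≤ n + n / 2 := Nat.le_add_left _ _
  have hmn : n + n / 2 - n / 2 = n := Nat.add_sub_cancel n (n / 2)
  calc (bondPercolation (zdGraph 3) p).real
        {ω | ∃ x ∈ box 3 n, ω ∈ openConnIn (↑(box 3 (n + n / 2)) : Set (Site 3)) v x}
      ≤ (bondPercolation (zdGraph 3) p).real
          {ω | ∃ x ∈ box 3 (n + n / 2 - n / 2),
            ω ∈ openConnVia (withinGraph (zdGraph 3) ↑(box 3 (n + n / 2))) v x} := by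
        refine real_mono_of_forall_subset_edgeSet (zdGraph 3) p fun ω hω h => ?_
        obtain ⟨x, hx, hωx⟩ := h
        refine ⟨x, by rw [hmn]; exact hx, ?_⟩
        exact mem_openConnVia_withinGraph_of_mem_openConnIn hω hvm hωx
    _ ≤ (bondPercolation (zdGraph 3) p).real (halfSpaceReach 3 (n / 2)) :=
        Subsurface.real_active_le_halfSpaceReach p hv htm

end Summit.CriticalPhenomena.PercolationContinuityZ3.Theorems.SubpolynomialBlocking
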